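import Literature.Probability.Process.BrownianSupTail
import HarnessLib

/-!
# Small-ball probabilities of Brownian motion: `P(sup_{s ≤ t} |B_s| ≤ ε) > 0`

Trunk T-PROBABILITY (Literature/Probability/Process). For the canonical Brownian motion `B` under
the pre-Wiener measure, every sup-norm ball around the zero path has positive probability:

* `measure_forall_abs_brownian_le_pos` — `P(∀ s ≤ t, |B_s| ≤ ε) > 0` for all `t ≥ 0`, `ε > 0`;
* `wienerPair_forall_abs_brownian_le_pos` — the same for the pair of independent Brownian motions
  (`wienerPair`, `BrownianPair.lean`): `P(∀ s ≤ t, |B¹_s| ≤ ε ∧ |B²_s| ≤ ε) > 0`.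

This is the support theorem of Wiener measure at the zero path (Stroock–Varadhan; Freedman,
*Brownian Motion and Diffusion* (1971), §1.6 Lemma (38): "`P{sup_{s≤t}|B_s| < ε} > 0`"), the
probabilistic half of the irreducibility of SDEs with additive noise (reach a neighbourhood of the
deterministic trajectory with positive probability).

Proof (elementary, from the weak Markov property and second moments only — no reflection
principle, no Cameron–Martin): cut `[0, t]` into `n` blocks of length `τ = t/n ≤ ε²/16`. Call block
`k` *good* if the increments `B_{kτ+u} - B_{kτ}`, `u ≤ τ`, stay in `[-ε/2, ε/2]` and the total
increment `B_{(k+1)τ} - B_{kτ}` lies in `[-ε/2, 0]` when `B_{kτ} ≥ 0`, in `[0, ε/2]` when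
`B_{kτ} < 0`. If the first `k` blocks are good then `|B_{kτ}| ≤ ε/2` and `|B_s| ≤ ε` on `[0, kτ]`
(induction). By the weak Markov property at `kτ` (Mathlib `IsPreBrownianReal.indepFun_shift`,
packaged as the factorisation `lintegral_comp_shift_eq`) and the Brownian law of the shifted path,
`P(first k+1 good) ≥ p₀ · P(first k good)` with
`p₀ = min_± P(sup_{u≤τ}|B_u| ≤ ε/2, ±B_τ ∈ [-ε/2, 0]) ≥ (1/2 - τ/(ε/2)²) - 2τ²/((ε/2)² - τ)² ≥ 1/36`
(Gaussian symmetry `P(B_τ ≤ 0) ≥ 1/2`, Chebyshev, and the Doob bound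
`measure_exists_le_abs_brownian_le` of `BrownianSupTail.lean`). Hence `P ≥ p₀ⁿ > 0`.

## References

* D. Freedman, *Brownian Motion and Diffusion* (Holden-Day, 1971), §1.6 Lemma (38).
* D. W. Stroock, S. R. S. Varadhan, *On the support of diffusion processes with applications to
  the strong maximum principle*, Proc. Sixth Berkeley Symp. III (1972) 333–359, §3.
* D. Revuz, M. Yor, *Continuous Martingales and Brownian Motion* (1999), Ch. III (simple Markov
  property), Ch. VIII §2 (Cameron–Martin; the classical route). [folklore]
-/

noncomputable section

open MeasureTheory ProbabilityTheory Filter Topology Set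
open scoped NNReal ENNReal

namespace Literature.Probability.Process

/-! ### The weak Markov property of one Brownian motion, as a factorisation of expectations -/

/-- **Markov factorisation of expectations for one Brownian motion.** For a nonnegative jointly
measurable `G`, a random variable `ξ` measurable with respect to the past `σ(B_u : u ≤ s)` and the
shifted path `θ_s ω = (B_{s+u} - B_s)_u`: `E[G(ξ, θ_s)] = E[ω ↦ ∫ G(ξ ω, B(ω')) dP(ω')]`
(independence of `θ_s` from the past, Mathlib `IsPreBrownianReal.indepFun_shift`, and
`law(θ_s) = law(B)`, `map_shift_eq_map_path`). The one-dimensional analogue of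
`lintegral_comp_pairShift_eq`. Revuz–Yor (1999), Ch. III §1. [folklore] -/
theorem lintegral_comp_shift_eq {X : Type*} [MeasurableSpace X] (s : ℝ≥0) {ξ : (ℝ≥0 → ℝ) → X}
    (hξ : Measurable[MeasurableSpace.comap (fun (ω : ℝ≥0 → ℝ) (u : Iic s) => brownian u ω)
      inferInstance] ξ)
    {G : X × (ℝ≥0 → ℝ) → ℝ≥0∞} (hG : Measurable G) :
    ∫⁻ ω, G (ξ ω, fun u => brownian (s + u) ω - brownian s ω) ∂preWienerMeasure =
      ∫⁻ ω, ∫⁻ ω', G (ξ ω, fun u => brownian u ω') ∂preWienerMeasure ∂preWienerMeasure := by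
  haveI := RandomPlanarGeometry.isProbabilityMeasure_preWienerMeasure'
  have hξm : Measurable ξ := hξ.mono (measurable_past s).comap_le le_rfl
  have hind : IndepFun ξ (fun (ω : ℝ≥0 → ℝ) (u : ℝ≥0) => brownian (s + u) ω - brownian s ω)
      preWienerMeasure := by
    have h := RandomPlanarGeometry.isPreBrownianReal_brownian.indepFun_shift s
    rw [IndepFun_iff_Indep] at h ⊢
    exact (indep_of_indep_of_le_right h (measurable_iff_comap_le.1 hξ)).symm
  have hlaw : preWienerMeasure.map (fun ω => (ξ ω, fun u => brownian (s + u) ω - brownian s ω)) =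
      (preWienerMeasure.map ξ).prod
        (preWienerMeasure.map fun (ω : ℝ≥0 → ℝ) (u : ℝ≥0) => brownian (s + u) ω - brownian s ω) :=
    (indepFun_iff_map_prod_eq_prod_map_map hξm.aemeasurable
      (measurable_shift s).aemeasurable).1 hind
  calc ∫⁻ ω, G (ξ ω, fun u => brownian (s + u) ω - brownian s ω) ∂preWienerMeasure
      = ∫⁻ p, G p ∂(preWienerMeasure.map fun ω =>
          (ξ ω, fun u => brownian (s + u) ω - brownian s ω)) := by
        rw [lintegral_map hG (hξm.prodMk (measurable_shift s))]
    _ = ∫⁻ p, G p ∂((preWienerMeasure.map ξ).prod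
          (preWienerMeasure.map fun (ω : ℝ≥0 → ℝ) (u : ℝ≥0) =>
            brownian (s + u) ω - brownian s ω)) := by rw [hlaw]
    _ = ∫⁻ x, ∫⁻ w, G (x, w) ∂(preWienerMeasure.map fun (ω : ℝ≥0 → ℝ) (u : ℝ≥0) =>
          brownian (s + u) ω - brownian s ω) ∂(preWienerMeasure.map ξ) :=
        lintegral_prod _ hG.aemeasurable
    _ = ∫⁻ x, ∫⁻ w, G (x, w) ∂(preWienerMeasure.map fun (ω : ℝ≥0 → ℝ) (u : ℝ≥0) => brownian u ω)
          ∂(preWienerMeasure.map ξ) := by rw [map_shift_eq_map_path]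
    _ = ∫⁻ x, ∫⁻ ω', G (x, fun u => brownian u ω') ∂preWienerMeasure ∂(preWienerMeasure.map ξ) := by
        congr 1
        funext x
        have hGx : Measurable fun w => G (x, w) := hG.comp (measurable_const.prodMk measurable_id)
        rw [lintegral_map hGx measurable_path]
    _ = ∫⁻ ω, ∫⁻ ω', G (ξ ω, fun u => brownian u ω') ∂preWienerMeasure ∂preWienerMeasure := by
        have hF : Measurable fun x => ∫⁻ ω', G (x, fun u => brownian u ω') ∂preWienerMeasure :=
          (hG.comp (measurable_fst.prodMk (measurable_path.comp measurable_snd))).lintegral_prod_right'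
        rw [lintegral_map hF hξm]

/-- Coordinates before time `s` are measurable with respect to the past `σ(B_u : u ≤ s)`.
[folklore] -/
theorem measurable_brownian_comap_past {s u : ℝ≥0} (hu : u ≤ s) :
    Measurable[MeasurableSpace.comap (fun (ω : ℝ≥0 → ℝ) (v : Iic s) => brownian v ω) inferInstance]
      (brownian u) := by
  have h : brownian u = (fun f : Iic s → ℝ => f ⟨u, hu⟩) ∘
      fun (ω : ℝ≥0 → ℝ) (v : Iic s) => brownian v ω := rfl
  rw [h]
  exact (measurable_pi_apply _).comp (comap_measurable _)

/-! ### Gaussian lower bounds: `P(N(0,v) ∈ [-α, 0]) ≥ 1/2 - v/α²` -/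

/-- `P(N(0, v) ≤ 0) ≥ 1/2` (symmetry of the centred Gaussian, Mathlib `gaussianReal_map_neg`).
[folklore] -/
theorem half_le_gaussianReal_Iic_zero (v : ℝ≥0) :
    ENNReal.ofReal (1 / 2) ≤ gaussianReal 0 v (Iic 0) := by
  set μ := gaussianReal 0 v with hμ
  have hsymm : μ (Ici 0) = μ (Iic 0) := by
    have h := gaussianReal_map_neg (μ := 0) (v := v)
    rw [neg_zero] at h
    calc μ (Ici 0) = (μ.map fun x => -x) (Ici 0) := by rw [h]
      _ = μ ((fun x : ℝ => -x) ⁻¹' Ici 0) := Measure.map_apply measurable_neg measurableSet_Ici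
      _ = μ (Iic 0) := by
          congr 1
          ext x
          simp
  have h1 : (1 : ℝ≥0∞) ≤ μ (Iic 0) + μ (Iic 0) := by
    nth_rw 2 [← hsymm]
    rw [← measure_univ (μ := μ)]
    calc μ univ ≤ μ (Iic 0 ∪ Ici 0) :=
          measure_mono fun x _ => (le_total x 0).elim (fun h => Or.inl h) fun h => Or.inr h
      _ ≤ μ (Iic 0) + μ (Ici 0) := measure_union_le _ _
  have h2 : ENNReal.ofReal (1 / 2) = 2⁻¹ := by
    rw [one_div, ENNReal.ofReal_inv_of_pos two_pos, ENNReal.ofReal_ofNat]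
  rw [h2, ← two_mul] at *
  calc (2 : ℝ≥0∞)⁻¹ = 2⁻¹ * 1 := (mul_one _).symm
    _ ≤ 2⁻¹ * (2 * μ (Iic 0)) := mul_le_mul' le_rfl h1
    _ = μ (Iic 0) := by
        rw [← mul_assoc, ENNReal.inv_mul_cancel two_ne_zero ENNReal.ofNat_ne_top, one_mul]

/-- **`P(N(0,v) ∈ [-α, 0]) ≥ 1/2 - v/α²`** (`P(≤ 0) ≥ 1/2` minus Chebyshev `P(|N| ≥ α) ≤ v/α²`).
[folklore] -/
theorem gaussianReal_Icc_neg_zero_ge (v : ℝ≥0) {α : ℝ} (hα : 0 < α) :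
    ENNReal.ofReal (1 / 2 - v / α ^ 2) ≤ gaussianReal 0 v (Icc (-α) 0) := by
  have hcheb : gaussianReal 0 v (Iio (-α)) ≤ ENNReal.ofReal (v / α ^ 2) := by
    have h := meas_ge_le_variance_div_sq (μ := gaussianReal 0 v) (X := id)
      (memLp_id_gaussianReal 2) hα
    have hint : ∫ x, id x ∂(gaussianReal 0 v) = 0 := integral_id_gaussianReal
    rw [hint, variance_id_gaussianReal] at h
    refine (measure_mono fun x hx => ?_).trans h
    simp only [mem_Iio] at hx
    simp only [id_eq, sub_zero, mem_setOf_eq]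
    rw [abs_of_neg (by linarith)]
    linarith
  set μ := gaussianReal 0 v with hμ
  have hsplit : μ (Iic 0) ≤ μ (Icc (-α) 0) + μ (Iio (-α)) := by
    calc μ (Iic 0) ≤ μ (Icc (-α) 0 ∪ Iio (-α)) := measure_mono fun x hx => by
            simp only [mem_Iic] at hx
            rcases lt_or_ge x (-α) with h | h
            · exact Or.inr h
            · exact Or.inl ⟨h, hx⟩
      _ ≤ μ (Icc (-α) 0) + μ (Iio (-α)) := measure_union_le _ _
  have hv : 0 ≤ (v : ℝ) / α ^ 2 := by positivity
  calc ENNReal.ofReal (1 / 2 - v / α ^ 2) = ENNReal.ofReal (1 / 2) - ENNReal.ofReal (v / α ^ 2) :=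
        ENNReal.ofReal_sub _ hv
    _ ≤ μ (Iic 0) - μ (Iio (-α)) := tsub_le_tsub (half_le_gaussianReal_Iic_zero v) hcheb
    _ ≤ μ (Icc (-α) 0) := tsub_le_iff_right.2 hsplit

/-- **`P(N(0,v) ∈ [0, α]) ≥ 1/2 - v/α²`** (the mirror image). [folklore] -/
theorem gaussianReal_Icc_zero_ge (v : ℝ≥0) {α : ℝ} (hα : 0 < α) :
    ENNReal.ofReal (1 / 2 - v / α ^ 2) ≤ gaussianReal 0 v (Icc 0 α) := by
  have h := gaussianReal_map_neg (μ := 0) (v := v)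
  rw [neg_zero] at h
  have : gaussianReal 0 v (Icc 0 α) = gaussianReal 0 v (Icc (-α) 0) := by
    calc gaussianReal 0 v (Icc 0 α) = ((gaussianReal 0 v).map fun x => -x) (Icc 0 α) := by rw [h]
      _ = gaussianReal 0 v ((fun x : ℝ => -x) ⁻¹' Icc 0 α) :=
          Measure.map_apply measurable_neg measurableSet_Icc
      _ = gaussianReal 0 v (Icc (-α) 0) := by
          congr 1
          ext x
          simp only [mem_preimage, mem_Icc, Left.nonneg_neg_iff, neg_le]
          tauto
  rw [this]
  exact gaussianReal_Icc_neg_zero_ge v hα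

/-! ### Abstract block bookkeeping -/

section Abstract

variable {α : Type*}

/-- `{∀ j < 0, ω ∈ B j} = univ`. [folklore] -/
theorem setOf_forall_lt_zero (B : ℕ → Set α) : {ω | ∀ j < 0, ω ∈ B j} = univ := by
  ext ω; simp

/-- `{∀ j < k+1, ω ∈ B j} = {∀ j < k, ω ∈ B j} ∩ B k`. [folklore] -/
theorem setOf_forall_lt_succ (B : ℕ → Set α) (k : ℕ) :
    {ω | ∀ j < k + 1, ω ∈ B j} = {ω | ∀ j < k, ω ∈ B j} ∩ B k := by
  ext ω
  simp only [mem_setOf_eq, mem_inter_iff]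
  constructor
  · intro h
    exact ⟨fun j hj => h j (Nat.lt_succ_of_lt hj), h k (Nat.lt_succ_self k)⟩
  · rintro ⟨h1, h2⟩ j hj
    rcases Nat.lt_succ_iff_lt_or_eq.1 hj with hj | rfl
    · exact h1 j hj
    · exact h2

/-- `{∀ j < k, ω ∈ B j}` is measurable if the `B j`, `j < k`, are. [folklore] -/
theorem measurableSet_setOf_forall_lt {m : MeasurableSpace α} {B : ℕ → Set α} {k : ℕ}
    (h : ∀ j < k, MeasurableSet[m] (B j)) : MeasurableSet[m] {ω | ∀ j < k, ω ∈ B j} := by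
  have : {ω | ∀ j < k, ω ∈ B j} = ⋂ j : ℕ, ⋂ (_ : j < k), B j := by
    ext ω; simp
  rw [this]
  exact MeasurableSet.iInter fun j => MeasurableSet.iInter fun hj => h j hj

/-- **Geometric lower bound from a one-step bound**: if `p₀ · μ{∀ j < k, B j} ≤ μ{∀ j < k+1, B j}`
for all `k`, then `p₀ᵏ ≤ μ{∀ j < k, B j}` (`μ` a probability measure). [folklore] -/
theorem pow_le_measure_setOf_forall_lt {m : MeasurableSpace α} (μ : Measure α) [IsProbabilityMeasure μ]
    (B : ℕ → Set α) (p₀ : ℝ≥0∞)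
    (hstep : ∀ k, p₀ * μ {ω | ∀ j < k, ω ∈ B j} ≤ μ {ω | ∀ j < k + 1, ω ∈ B j}) (k : ℕ) :
    p₀ ^ k ≤ μ {ω | ∀ j < k, ω ∈ B j} := by
  induction k with
  | zero => simp
  | succ k ih =>
    calc p₀ ^ (k + 1) = p₀ * p₀ ^ k := by ring
      _ ≤ p₀ * μ {ω | ∀ j < k, ω ∈ B j} := mul_le_mul' le_rfl ih
      _ ≤ μ {ω | ∀ j < k + 1, ω ∈ B j} := hstep k

end Abstract

/-! ### The block event on path space -/

/-- **The block event is measurable.** The block event with sign bit `b` on raw paths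
`w : ℝ≥0 → ℝ` is: `|w| ≤ ε/2` at the dyadic times `m/2ⁿ ≤ τ` (hence on `[0, τ]` if `w` is
continuous) and the endpoint condition `w(τ) ∈ [-ε/2, 0]` (`b = true`) resp. `w(τ) ∈ [0, ε/2]`
(`b = false`); a countable intersection of cylinder conditions. [folklore] -/
theorem measurableSet_blockEvent (τ : ℝ≥0) (ε : ℝ) (b : Bool) :
    MeasurableSet {w : ℝ≥0 → ℝ | (∀ n m : ℕ, ((m : ℝ≥0) / 2 ^ n ≤ τ) →
        |w ((m : ℝ≥0) / 2 ^ n)| ≤ ε / 2) ∧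
      (if b then w τ ∈ Icc (-(ε / 2)) 0 else w τ ∈ Icc 0 (ε / 2))} := by
  have h1 : MeasurableSet {w : ℝ≥0 → ℝ | ∀ n m : ℕ, ((m : ℝ≥0) / 2 ^ n ≤ τ) →
      |w ((m : ℝ≥0) / 2 ^ n)| ≤ ε / 2} := by
    have : {w : ℝ≥0 → ℝ | ∀ n m : ℕ, ((m : ℝ≥0) / 2 ^ n ≤ τ) → |w ((m : ℝ≥0) / 2 ^ n)| ≤ ε / 2} =
        ⋂ n : ℕ, ⋂ m : ℕ, {w | ((m : ℝ≥0) / 2 ^ n ≤ τ) → |w ((m : ℝ≥0) / 2 ^ n)| ≤ ε / 2} := by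
      ext w; simp
    rw [this]
    refine MeasurableSet.iInter fun n => MeasurableSet.iInter fun m => ?_
    by_cases hmn : (m : ℝ≥0) / 2 ^ n ≤ τ
    · simp only [hmn, forall_const]
      exact measurableSet_le (measurable_pi_apply _).abs measurable_const
    · simp [hmn]
  have h2 : MeasurableSet {w : ℝ≥0 → ℝ | if b then w τ ∈ Icc (-(ε / 2)) 0 else w τ ∈ Icc 0 (ε / 2)} := by
    cases b
    · simp only [Bool.false_eq_true, ↓reduceIte]
      exact measurableSet_Icc.preimage (measurable_pi_apply τ)
    · simp only [↓reduceIte]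
      exact measurableSet_Icc.preimage (measurable_pi_apply τ)
  exact h1.inter h2

/-- **From the dyadic grid to the whole interval**: a continuous path bounded by `c` at the dyadic
times `m/2ⁿ ≤ τ` is bounded by `c` on `[0, τ]`. [folklore] -/
theorem abs_le_of_dyadic {w : ℝ≥0 → ℝ} (hw : Continuous w) {τ : ℝ≥0} {c : ℝ}
    (h : ∀ n m : ℕ, ((m : ℝ≥0) / 2 ^ n ≤ τ) → |w ((m : ℝ≥0) / 2 ^ n)| ≤ c) {u : ℝ≥0}
    (hu : u ≤ τ) : |w u| ≤ c := by
  set r : ℕ → ℝ≥0 := fun n => ((⌊(u : ℝ) * 2 ^ n⌋₊ : ℕ) : ℝ≥0) / 2 ^ n with hr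
  have hru : ∀ n, r n ≤ u := fun n => by
    show ((⌊(u : ℝ) * 2 ^ n⌋₊ : ℕ) : ℝ≥0) / 2 ^ n ≤ u
    rw [div_le_iff₀ (pow_pos two_pos n), ← NNReal.coe_le_coe]
    push_cast
    exact Nat.floor_le (by positivity)
  have hten : Tendsto r atTop (𝓝 u) := tendsto_nat_floor_div_two_pow u
  have hc : Tendsto (fun n => |w (r n)|) atTop (𝓝 |w u|) :=
    ((continuous_abs.comp hw).tendsto u).comp hten
  exact le_of_tendsto' hc fun n => h n _ ((hru n).trans hu)

/-! ### Good blocks of the Brownian path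

Below, `E b` stands for the block event with sign bit `b` and `B k` for the event "block `k` is
good": the shifted path `θ_{kτ} ω = (B_{kτ+u} - B_{kτ})_u` lies in `E [B_{kτ} ≥ 0]`. Both are
passed as parameters together with their defining equations (`hE`, `hB`), to keep the statements
short; the small-ball theorem instantiates them. -/

section Blocks

variable {τ : ℝ≥0} {ε : ℝ} {E : Bool → Set (ℝ≥0 → ℝ)} {B : ℕ → Set (ℝ≥0 → ℝ)}
  (hE : ∀ b, E b = {w : ℝ≥0 → ℝ | (∀ n m : ℕ, ((m : ℝ≥0) / 2 ^ n ≤ τ) →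
      |w ((m : ℝ≥0) / 2 ^ n)| ≤ ε / 2) ∧ (if b then w τ ∈ Icc (-(ε / 2)) 0 else w τ ∈ Icc 0 (ε / 2))})
  (hB : ∀ k : ℕ, B k = {ω | (fun u => brownian ((k : ℝ≥0) * τ + u) ω - brownian ((k : ℝ≥0) * τ) ω) ∈
      E (decide (0 ≤ brownian ((k : ℝ≥0) * τ) ω))})

include hE in
/-- The block events are measurable. [folklore] -/
theorem measurableSet_of_eq_blockEvent (b : Bool) : MeasurableSet (E b) := by
  rw [hE]
  exact measurableSet_blockEvent τ ε b

include hE hB in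
/-- Unfolding "block `k` is good". [folklore] -/
theorem mem_blockGood_iff (k : ℕ) (ω : ℝ≥0 → ℝ) :
    ω ∈ B k ↔
      (∀ n m : ℕ, ((m : ℝ≥0) / 2 ^ n ≤ τ) →
        |brownian ((k : ℝ≥0) * τ + (m : ℝ≥0) / 2 ^ n) ω - brownian ((k : ℝ≥0) * τ) ω| ≤ ε / 2) ∧
      (if decide (0 ≤ brownian ((k : ℝ≥0) * τ) ω) then
        brownian ((k : ℝ≥0) * τ + τ) ω - brownian ((k : ℝ≥0) * τ) ω ∈ Icc (-(ε / 2)) 0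
       else brownian ((k : ℝ≥0) * τ + τ) ω - brownian ((k : ℝ≥0) * τ) ω ∈ Icc 0 (ε / 2)) := by
  rw [hB, mem_setOf_eq, hE, mem_setOf_eq]

include hE hB in
/-- Measurability of "block `k` is good" with respect to any σ-algebra making the coordinates up
to time `(k+1)τ` measurable. [folklore] -/
theorem measurableSet_blockGood' {m : MeasurableSpace (ℝ≥0 → ℝ)} (k : ℕ)
    (hm : ∀ u : ℝ≥0, u ≤ (k : ℝ≥0) * τ + τ → Measurable[m] (brownian u)) :
    MeasurableSet[m] (B k) := by
  have hk : Measurable[m] (brownian ((k : ℝ≥0) * τ)) := hm _ le_self_add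
  have hkτ : Measurable[m] (brownian ((k : ℝ≥0) * τ + τ)) := hm _ le_rfl
  have hset : B k =
      {ω : ℝ≥0 → ℝ | ∀ n j : ℕ, ((j : ℝ≥0) / 2 ^ n ≤ τ) →
        |brownian ((k : ℝ≥0) * τ + (j : ℝ≥0) / 2 ^ n) ω - brownian ((k : ℝ≥0) * τ) ω| ≤ ε / 2} ∩
      (({ω | 0 ≤ brownian ((k : ℝ≥0) * τ) ω} ∩
          {ω | brownian ((k : ℝ≥0) * τ + τ) ω - brownian ((k : ℝ≥0) * τ) ω ∈ Icc (-(ε / 2)) 0}) ∪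
        ({ω | ¬ 0 ≤ brownian ((k : ℝ≥0) * τ) ω} ∩
          {ω | brownian ((k : ℝ≥0) * τ + τ) ω - brownian ((k : ℝ≥0) * τ) ω ∈ Icc 0 (ε / 2)})) := by
    ext ω
    rw [mem_blockGood_iff hE hB]
    simp only [mem_setOf_eq, mem_union, mem_inter_iff]
    by_cases h0 : 0 ≤ brownian ((k : ℝ≥0) * τ) ω
    · simp [h0]
    · simp [h0]
  rw [hset]
  refine MeasurableSet.inter ?_ (MeasurableSet.union ((measurableSet_le measurable_const hk).inter ?_)
      ((measurableSet_le measurable_const hk).compl.inter ?_))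
  · have : {ω : ℝ≥0 → ℝ | ∀ n j : ℕ, ((j : ℝ≥0) / 2 ^ n ≤ τ) →
        |brownian ((k : ℝ≥0) * τ + (j : ℝ≥0) / 2 ^ n) ω - brownian ((k : ℝ≥0) * τ) ω| ≤ ε / 2} =
        ⋂ n : ℕ, ⋂ j : ℕ, {ω | ((j : ℝ≥0) / 2 ^ n ≤ τ) →
          |brownian ((k : ℝ≥0) * τ + (j : ℝ≥0) / 2 ^ n) ω - brownian ((k : ℝ≥0) * τ) ω| ≤ ε / 2} := by
      ext ω; simp
    rw [this]
    refine MeasurableSet.iInter fun n => MeasurableSet.iInter fun j => ?_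
    by_cases hjn : (j : ℝ≥0) / 2 ^ n ≤ τ
    · simp only [hjn, forall_const]
      exact measurableSet_le ((hm _ (by gcongr)).sub hk).abs measurable_const
    · simp [hjn]
  · exact measurableSet_Icc.preimage (hkτ.sub hk)
  · exact measurableSet_Icc.preimage (hkτ.sub hk)

include hE hB in
/-- "Block `k` is good" is measurable. [folklore] -/
theorem measurableSet_blockGood (k : ℕ) : MeasurableSet (B k) :=
  measurableSet_blockGood' hE hB k fun u _ => measurable_brownian u

include hE hB in
/-- "The first `k` blocks are good" is measurable with respect to the past `σ(B_u : u ≤ kτ)`.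
[folklore] -/
theorem measurableSet_goodUpTo_comap (k : ℕ) :
    MeasurableSet[MeasurableSpace.comap (fun (ω : ℝ≥0 → ℝ) (v : Iic ((k : ℝ≥0) * τ)) => brownian v ω)
      inferInstance] {ω | ∀ j < k, ω ∈ B j} := by
  refine measurableSet_setOf_forall_lt fun j hj => ?_
  refine measurableSet_blockGood' hE hB j fun u hu => measurable_brownian_comap_past (hu.trans ?_)
  calc (j : ℝ≥0) * τ + τ = ((j : ℝ≥0) + 1) * τ := by ring
    _ ≤ (k : ℝ≥0) * τ := by
        gcongr
        exact_mod_cast Nat.succ_le_of_lt hj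

include hE hB in
/-- "The first `k` blocks are good" is measurable. [folklore] -/
theorem measurableSet_goodUpTo (k : ℕ) : MeasurableSet {ω | ∀ j < k, ω ∈ B j} :=
  measurableSet_setOf_forall_lt fun j _ => measurableSet_blockGood hE hB j

/-! ### Good blocks confine the path -/

include hE hB in
/-- **If the first `k` blocks are good then `|B_{kτ}| ≤ ε/2` and `|B_s| ≤ ε` for `s ≤ kτ`**
(induction on `k`; the sign rule keeps the anchor `B_{kτ}` in `[-ε/2, ε/2]`, and inside a block
the path moves by at most `ε/2`, by continuity from the dyadic grid). [folklore] -/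
theorem abs_brownian_le_of_mem_goodUpTo (hε : 0 ≤ ε) {k : ℕ} {ω : ℝ≥0 → ℝ}
    (hω : ω ∈ {ω | ∀ j < k, ω ∈ B j}) :
    |brownian ((k : ℝ≥0) * τ) ω| ≤ ε / 2 ∧ ∀ s : ℝ≥0, s ≤ (k : ℝ≥0) * τ → |brownian s ω| ≤ ε := by
  induction k with
  | zero =>
    simp only [Nat.cast_zero, zero_mul, brownian_zero, Pi.zero_apply, abs_zero, nonpos_iff_eq_zero]
    refine ⟨by linarith, fun s hs => ?_⟩
    rw [hs]
    simp only [brownian_zero, Pi.zero_apply, abs_zero]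
    exact hε
  | succ k ih =>
    rw [setOf_forall_lt_succ] at hω
    obtain ⟨hanchor, hpath⟩ := ih hω.1
    obtain ⟨hdyad, hsign⟩ := (mem_blockGood_iff hE hB k ω).1 hω.2
    have hcast : ((k + 1 : ℕ) : ℝ≥0) * τ = (k : ℝ≥0) * τ + τ := by push_cast; ring
    -- inside the block the path moves by at most `ε/2`
    have hmove : ∀ u : ℝ≥0, u ≤ τ →
        |brownian ((k : ℝ≥0) * τ + u) ω - brownian ((k : ℝ≥0) * τ) ω| ≤ ε / 2 := fun u hu =>
      abs_le_of_dyadic (w := fun u => brownian ((k : ℝ≥0) * τ + u) ω - brownian ((k : ℝ≥0) * τ) ω)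
        (((continuous_brownian ω).comp (continuous_const.add continuous_id)).sub continuous_const)
        hdyad hu
    -- the new anchor
    have hanchor' : |brownian ((k : ℝ≥0) * τ + τ) ω| ≤ ε / 2 := by
      rw [abs_le] at hanchor ⊢
      by_cases h0 : 0 ≤ brownian ((k : ℝ≥0) * τ) ω
      · simp only [h0, decide_true, ↓reduceIte, mem_Icc] at hsign
        constructor <;> linarith [hsign.1, hsign.2]
      · simp only [h0, decide_false, Bool.false_eq_true, ↓reduceIte, mem_Icc] at hsign
        push Not at h0
        constructor <;> linarith [hsign.1, hsign.2]
    refine ⟨by rw [hcast]; exact hanchor', fun s hs => ?_⟩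
    rw [hcast] at hs
    rcases le_or_gt s ((k : ℝ≥0) * τ) with hsk | hsk
    · exact hpath s hsk
    · -- `s = kτ + u` with `u ≤ τ`
      set u : ℝ≥0 := s - (k : ℝ≥0) * τ with hu
      have hsu : s = (k : ℝ≥0) * τ + u := by rw [hu, add_tsub_cancel_of_le hsk.le]
      have huτ : u ≤ τ := by
        rw [hu]
        exact tsub_le_iff_left.2 hs
      rw [hsu]
      have h1 := hmove u huτ
      have h2 : brownian ((k : ℝ≥0) * τ + u) ω =
          (brownian ((k : ℝ≥0) * τ + u) ω - brownian ((k : ℝ≥0) * τ) ω) +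
            brownian ((k : ℝ≥0) * τ) ω := by ring
      rw [h2]
      calc |brownian ((k : ℝ≥0) * τ + u) ω - brownian ((k : ℝ≥0) * τ) ω + brownian ((k : ℝ≥0) * τ) ω|
          ≤ |brownian ((k : ℝ≥0) * τ + u) ω - brownian ((k : ℝ≥0) * τ) ω| +
              |brownian ((k : ℝ≥0) * τ) ω| := abs_add_le _ _
        _ ≤ ε / 2 + ε / 2 := add_le_add h1 hanchor
        _ = ε := by ring

end Blocks

/-! ### The Markov step: `P(first k+1 blocks good) ≥ p₀ · P(first k blocks good)` -/

/-- **The Markov step, abstract form.** For a past-measurable event `A` and a past-measurable bit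
`σ` at time `s`, and measurable path events `E b`:
`P(A ∩ {θ_s ω ∈ E (σ ω)}) ≥ min_b P(B ∈ E b) · P(A)` — condition on the past at time `s`; the
event of the shifted path has the probability of the unshifted one, whatever the bit. [folklore] -/
theorem measure_inter_shift_preimage_ge (s : ℝ≥0) {A : Set (ℝ≥0 → ℝ)}
    (hA : MeasurableSet[MeasurableSpace.comap (fun (ω : ℝ≥0 → ℝ) (v : Iic s) => brownian v ω)
      inferInstance] A)
    {σ : (ℝ≥0 → ℝ) → Bool}
    (hσ : Measurable[MeasurableSpace.comap (fun (ω : ℝ≥0 → ℝ) (v : Iic s) => brownian v ω)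
      inferInstance] σ)
    (E : Bool → Set (ℝ≥0 → ℝ)) (hE : ∀ b, MeasurableSet (E b)) :
    min (preWienerMeasure ((fun (ω : ℝ≥0 → ℝ) (u : ℝ≥0) => brownian u ω) ⁻¹' E true))
        (preWienerMeasure ((fun (ω : ℝ≥0 → ℝ) (u : ℝ≥0) => brownian u ω) ⁻¹' E false)) *
      preWienerMeasure A ≤
      preWienerMeasure (A ∩ {ω | (fun u => brownian (s + u) ω - brownian s ω) ∈ E (σ ω)}) := by
  classical
  set p₀ : ℝ≥0∞ := min (preWienerMeasure ((fun (ω : ℝ≥0 → ℝ) (u : ℝ≥0) => brownian u ω) ⁻¹' E true))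
    (preWienerMeasure ((fun (ω : ℝ≥0 → ℝ) (u : ℝ≥0) => brownian u ω) ⁻¹' E false)) with hp₀
  have hAm : MeasurableSet A := (measurable_past s).comap_le A hA
  have hσm : Measurable σ := hσ.mono (measurable_past s).comap_le le_rfl
  -- the past-measurable data `ξ = (1_A, σ)` and the integrand `G = 1_S`
  let ξ : (ℝ≥0 → ℝ) → Bool × Bool := fun ω => (decide (ω ∈ A), σ ω)
  let S : Set ((Bool × Bool) × (ℝ≥0 → ℝ)) := {p | p.1.1 = true ∧ p.2 ∈ E p.1.2}
  have hS : MeasurableSet S := by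
    have : S = ⋃ b : Bool, ({(true, b)} : Set (Bool × Bool)) ×ˢ E b := by
      ext ⟨⟨a, b⟩, w⟩
      simp only [mem_setOf_eq, mem_iUnion, mem_prod, mem_singleton_iff, Prod.mk.injEq, S]
      constructor
      · rintro ⟨rfl, hw⟩
        exact ⟨b, ⟨rfl, rfl⟩, hw⟩
      · rintro ⟨b', ⟨rfl, rfl⟩, hw⟩
        exact ⟨rfl, hw⟩
    rw [this]
    exact MeasurableSet.iUnion fun b => (measurableSet_singleton _).prod (hE b)
  let G : (Bool × Bool) × (ℝ≥0 → ℝ) → ℝ≥0∞ := S.indicator 1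
  have hG : Measurable G := measurable_one.indicator hS
  have hξ : Measurable[MeasurableSpace.comap (fun (ω : ℝ≥0 → ℝ) (v : Iic s) => brownian v ω)
      inferInstance] ξ := by
    refine Measurable.prodMk ?_ hσ
    refine measurable_to_bool ?_
    have : (fun ω => decide (ω ∈ A)) ⁻¹' {true} = A := by
      ext ω; simp
    rw [this]
    exact hA
  have hfac := lintegral_comp_shift_eq s hξ hG
  -- the left-hand side is `P(A ∩ {θ_s ∈ E σ})`
  have hL : ∀ ω, G (ξ ω, fun u => brownian (s + u) ω - brownian s ω) =
      (A ∩ {ω | (fun u => brownian (s + u) ω - brownian s ω) ∈ E (σ ω)}).indicator 1 ω := by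
    intro ω
    by_cases h1 : ω ∈ A
    · by_cases h2 : (fun u => brownian (s + u) ω - brownian s ω) ∈ E (σ ω)
      · have hmem : (ξ ω, fun u => brownian (s + u) ω - brownian s ω) ∈ S := ⟨by simp [ξ, h1], h2⟩
        have hmem' : ω ∈ A ∩ {ω | (fun u => brownian (s + u) ω - brownian s ω) ∈ E (σ ω)} :=
          ⟨h1, h2⟩
        simp only [G, indicator_of_mem hmem, indicator_of_mem hmem', Pi.one_apply]
      · have hmem : (ξ ω, fun u => brownian (s + u) ω - brownian s ω) ∉ S := fun h => h2 h.2
        have hmem' : ω ∉ A ∩ {ω | (fun u => brownian (s + u) ω - brownian s ω) ∈ E (σ ω)} :=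
          fun h => h2 h.2
        simp only [G, indicator_of_notMem hmem, indicator_of_notMem hmem']
    · have hmem : (ξ ω, fun u => brownian (s + u) ω - brownian s ω) ∉ S := fun h => by
        have h' := h.1
        simp [ξ, h1] at h'
      have hmem' : ω ∉ A ∩ {ω | (fun u => brownian (s + u) ω - brownian s ω) ∈ E (σ ω)} :=
        fun h => h1 h.1
      simp only [G, indicator_of_notMem hmem, indicator_of_notMem hmem']
  -- the inner integral on the right is `≥ p₀` on `A`
  have hR : ∀ ω, A.indicator (fun _ => p₀) ω ≤
      ∫⁻ ω', G (ξ ω, fun u => brownian u ω') ∂preWienerMeasure := by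
    intro ω
    by_cases h1 : ω ∈ A
    · rw [indicator_of_mem h1]
      have hint : ∀ ω', G (ξ ω, fun u => brownian u ω') =
          ((fun (ω' : ℝ≥0 → ℝ) (u : ℝ≥0) => brownian u ω') ⁻¹' E (σ ω)).indicator 1 ω' := by
        intro ω'
        by_cases h2 : (fun u => brownian u ω') ∈ E (σ ω)
        · have hmem : (ξ ω, fun u => brownian u ω') ∈ S := ⟨by simp [ξ, h1], h2⟩
          have hmem' : ω' ∈ (fun (ω' : ℝ≥0 → ℝ) (u : ℝ≥0) => brownian u ω') ⁻¹' E (σ ω) := h2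
          simp only [G, indicator_of_mem hmem, indicator_of_mem hmem', Pi.one_apply]
        · have hmem : (ξ ω, fun u => brownian u ω') ∉ S := fun h => h2 h.2
          have hmem' : ω' ∉ (fun (ω' : ℝ≥0 → ℝ) (u : ℝ≥0) => brownian u ω') ⁻¹' E (σ ω) := h2
          simp only [G, indicator_of_notMem hmem, indicator_of_notMem hmem']
      simp_rw [hint]
      rw [lintegral_indicator_one ((hE _).preimage measurable_path)]
      cases σ ω
      · exact min_le_right _ _
      · exact min_le_left _ _
    · rw [indicator_of_notMem h1]
      exact zero_le
  calc p₀ * preWienerMeasure A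
      = ∫⁻ ω, A.indicator (fun _ => p₀) ω ∂preWienerMeasure := (lintegral_indicator_const hAm p₀).symm
    _ ≤ ∫⁻ ω, ∫⁻ ω', G (ξ ω, fun u => brownian u ω') ∂preWienerMeasure ∂preWienerMeasure :=
        lintegral_mono hR
    _ = ∫⁻ ω, G (ξ ω, fun u => brownian (s + u) ω - brownian s ω) ∂preWienerMeasure := hfac.symm
    _ = ∫⁻ ω, (A ∩ {ω | (fun u => brownian (s + u) ω - brownian s ω) ∈ E (σ ω)}).indicator 1 ω
          ∂preWienerMeasure := by simp_rw [hL]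
    _ = preWienerMeasure (A ∩ {ω | (fun u => brownian (s + u) ω - brownian s ω) ∈ E (σ ω)}) :=
        lintegral_indicator_one (hAm.inter (by
          -- measurability of `{θ_s ∈ E σ}`: split on the bit
          have hθ : Measurable fun (ω : ℝ≥0 → ℝ) (u : ℝ≥0) => brownian (s + u) ω - brownian s ω :=
            measurable_shift s
          have : {ω : ℝ≥0 → ℝ | (fun u => brownian (s + u) ω - brownian s ω) ∈ E (σ ω)} =
              ({ω | σ ω = true} ∩ (fun (ω : ℝ≥0 → ℝ) (u : ℝ≥0) => brownian (s + u) ω - brownian s ω) ⁻¹'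
                E true) ∪
              ({ω | σ ω = false} ∩ (fun (ω : ℝ≥0 → ℝ) (u : ℝ≥0) => brownian (s + u) ω - brownian s ω) ⁻¹'
                E false) := by
            ext ω
            simp only [mem_setOf_eq, mem_union, mem_inter_iff, mem_preimage]
            cases σ ω <;> simp
          rw [this]
          exact ((measurableSet_singleton true).preimage hσm |>.inter ((hE true).preimage hθ)).union
            ((measurableSet_singleton false).preimage hσm |>.inter ((hE false).preimage hθ))))

section Blocks

variable {τ : ℝ≥0} {ε : ℝ} {E : Bool → Set (ℝ≥0 → ℝ)} {B : ℕ → Set (ℝ≥0 → ℝ)}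
  (hE : ∀ b, E b = {w : ℝ≥0 → ℝ | (∀ n m : ℕ, ((m : ℝ≥0) / 2 ^ n ≤ τ) →
      |w ((m : ℝ≥0) / 2 ^ n)| ≤ ε / 2) ∧ (if b then w τ ∈ Icc (-(ε / 2)) 0 else w τ ∈ Icc 0 (ε / 2))})
  (hB : ∀ k : ℕ, B k = {ω | (fun u => brownian ((k : ℝ≥0) * τ + u) ω - brownian ((k : ℝ≥0) * τ) ω) ∈
      E (decide (0 ≤ brownian ((k : ℝ≥0) * τ) ω))})

include hE hB in
/-- **The Markov step**: `P(first k+1 blocks good) ≥ min_b P(B ∈ E b) · P(first k blocks good)`.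
[folklore] -/
theorem measure_goodUpTo_succ_ge (k : ℕ) :
    min (preWienerMeasure ((fun (ω : ℝ≥0 → ℝ) (u : ℝ≥0) => brownian u ω) ⁻¹' E true))
        (preWienerMeasure ((fun (ω : ℝ≥0 → ℝ) (u : ℝ≥0) => brownian u ω) ⁻¹' E false)) *
      preWienerMeasure {ω | ∀ j < k, ω ∈ B j} ≤ preWienerMeasure {ω | ∀ j < k + 1, ω ∈ B j} := by
  have hσ : Measurable[MeasurableSpace.comap (fun (ω : ℝ≥0 → ℝ) (v : Iic ((k : ℝ≥0) * τ)) =>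
      brownian v ω) inferInstance] (fun ω => decide (0 ≤ brownian ((k : ℝ≥0) * τ) ω)) := by
    refine measurable_to_bool ?_
    have : (fun ω => decide (0 ≤ brownian ((k : ℝ≥0) * τ) ω)) ⁻¹' {true} =
        {ω | 0 ≤ brownian ((k : ℝ≥0) * τ) ω} := by
      ext ω; simp
    rw [this]
    exact measurableSet_le measurable_const (measurable_brownian_comap_past le_rfl)
  have h := measure_inter_shift_preimage_ge ((k : ℝ≥0) * τ) (measurableSet_goodUpTo_comap hE hB k)
    hσ E (measurableSet_of_eq_blockEvent hE)
  rw [setOf_forall_lt_succ, hB k]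
  exact h

include hE hB in
/-- **`P(first k blocks good) ≥ p₀ᵏ`**, `p₀ = min_b P(B ∈ E b)`. [folklore] -/
theorem pow_le_measure_goodUpTo (k : ℕ) :
    min (preWienerMeasure ((fun (ω : ℝ≥0 → ℝ) (u : ℝ≥0) => brownian u ω) ⁻¹' E true))
        (preWienerMeasure ((fun (ω : ℝ≥0 → ℝ) (u : ℝ≥0) => brownian u ω) ⁻¹' E false)) ^ k ≤
      preWienerMeasure {ω | ∀ j < k, ω ∈ B j} := by
  haveI := RandomPlanarGeometry.isProbabilityMeasure_preWienerMeasure'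
  exact pow_le_measure_setOf_forall_lt preWienerMeasure B _ (measure_goodUpTo_succ_ge hE hB) k

end Blocks

/-! ### One block is good with probability at least `1/36` -/

/-- **A short block is good with positive probability**: for `0 < ε` and `τ ≤ ε²/16`,
`P(B ∈ E b) ≥ P(±B_τ ∈ [-ε/2, 0]) - P(∃ s ≤ τ, |B_s| ≥ ε/2) ≥ (1/2 - 1/4) - 2/9 > 0`.
[folklore] -/
theorem blockProb_pos {τ : ℝ≥0} {ε : ℝ} (hε : 0 < ε) (hτ : (τ : ℝ) ≤ ε ^ 2 / 16) (b : Bool) :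
    0 < preWienerMeasure ((fun (ω : ℝ≥0 → ℝ) (u : ℝ≥0) => brownian u ω) ⁻¹'
      {w : ℝ≥0 → ℝ | (∀ n m : ℕ, ((m : ℝ≥0) / 2 ^ n ≤ τ) → |w ((m : ℝ≥0) / 2 ^ n)| ≤ ε / 2) ∧
        (if b then w τ ∈ Icc (-(ε / 2)) 0 else w τ ∈ Icc 0 (ε / 2))}) := by
  haveI := RandomPlanarGeometry.isProbabilityMeasure_preWienerMeasure'
  -- the endpoint event `A` and the bad event
  set A : Set (ℝ≥0 → ℝ) := {ω | if b then brownian τ ω ∈ Icc (-(ε / 2)) 0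
    else brownian τ ω ∈ Icc 0 (ε / 2)} with hA
  set Bad : Set (ℝ≥0 → ℝ) := {ω | ∃ s ≤ τ, ε / 2 ≤ |brownian s ω|} with hBad
  have hsub : A \ Bad ⊆ (fun (ω : ℝ≥0 → ℝ) (u : ℝ≥0) => brownian u ω) ⁻¹'
      {w : ℝ≥0 → ℝ | (∀ n m : ℕ, ((m : ℝ≥0) / 2 ^ n ≤ τ) → |w ((m : ℝ≥0) / 2 ^ n)| ≤ ε / 2) ∧
        (if b then w τ ∈ Icc (-(ε / 2)) 0 else w τ ∈ Icc 0 (ε / 2))} := by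
    rintro ω ⟨hωA, hωB⟩
    refine ⟨fun n m hmn => ?_, ?_⟩
    · by_contra hlt
      push Not at hlt
      exact hωB ⟨_, hmn, hlt.le⟩
    · simpa [hA] using hωA
  -- `P(A) ≥ 1/4`
  have hτε : (τ : ℝ) / (ε / 2) ^ 2 ≤ 1 / 4 := by
    rw [div_le_iff₀ (by positivity)]
    nlinarith
  have hPA : ENNReal.ofReal (1 / 4) ≤ preWienerMeasure A := by
    have hlaw := (RandomPlanarGeometry.isPreBrownianReal_brownian.hasLaw_eval τ).map_eq
    have hAeq : A = brownian τ ⁻¹' (if b then Icc (-(ε / 2)) 0 else Icc 0 (ε / 2)) := by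
      ext ω; cases b <;> simp [hA]
    have hmeas : MeasurableSet (if b then Icc (-(ε / 2)) 0 else Icc 0 (ε / 2) : Set ℝ) := by
      cases b <;> exact measurableSet_Icc
    rw [hAeq, ← Measure.map_apply (measurable_brownian τ) hmeas, hlaw]
    calc ENNReal.ofReal (1 / 4) ≤ ENNReal.ofReal (1 / 2 - τ / (ε / 2) ^ 2) :=
          ENNReal.ofReal_le_ofReal (by linarith)
      _ ≤ gaussianReal 0 τ (if b then Icc (-(ε / 2)) 0 else Icc 0 (ε / 2)) := by
          cases b
          · exact gaussianReal_Icc_zero_ge τ (half_pos hε)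
          · exact gaussianReal_Icc_neg_zero_ge τ (half_pos hε)
  -- `P(Bad) ≤ 2/9`
  have hPBad : preWienerMeasure Bad ≤ ENNReal.ofReal (2 / 9) := by
    have hτ4 : (τ : ℝ) < (ε / 2) ^ 2 := by nlinarith
    refine (measure_exists_le_abs_brownian_le τ (half_pos hε).le hτ4).trans
      (ENNReal.ofReal_le_ofReal ?_)
    have hden : 3 * ε ^ 2 / 16 ≤ (ε / 2) ^ 2 - τ := by nlinarith
    have hden0 : 0 < 3 * ε ^ 2 / 16 := by positivity
    have hτ0 : (0 : ℝ) ≤ τ := τ.coe_nonneg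
    rw [div_le_iff₀ (by positivity)]
    have h1 : (τ : ℝ) ^ 2 ≤ (ε ^ 2 / 16) ^ 2 := pow_le_pow_left₀ hτ0 hτ (2)
    have h2 : (3 * ε ^ 2 / 16) ^ 2 ≤ ((ε / 2) ^ 2 - τ) ^ 2 := pow_le_pow_left₀ hden0.le hden 2
    nlinarith
  -- conclude
  have hlt : preWienerMeasure Bad < preWienerMeasure A :=
    lt_of_le_of_lt hPBad (lt_of_lt_of_le ((ENNReal.ofReal_lt_ofReal_iff (by norm_num)).2
      (by norm_num)) hPA)
  calc (0 : ℝ≥0∞) < preWienerMeasure A - preWienerMeasure Bad := tsub_pos_of_lt hlt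
    _ ≤ preWienerMeasure (A \ Bad) := by
        refine tsub_le_iff_right.2 ?_
        calc preWienerMeasure A ≤ preWienerMeasure ((A \ Bad) ∪ Bad) :=
              measure_mono (fun ω hω => by
                by_cases h : ω ∈ Bad
                · exact Or.inr h
                · exact Or.inl ⟨hω, h⟩)
          _ ≤ preWienerMeasure (A \ Bad) + preWienerMeasure Bad := measure_union_le _ _
    _ ≤ _ := measure_mono hsub

/-! ### The small-ball theorem -/

/-- **Small balls of Wiener measure have positive probability**: for every `t ≥ 0` and `ε > 0`,
`P(∀ s ≤ t, |B_s| ≤ ε) > 0` for the canonical Brownian motion under the pre-Wiener measure.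
Freedman (1971), §1.6 Lemma (38); Stroock–Varadhan (1972), §3 (support of Wiener measure).
[folklore] -/
theorem measure_forall_abs_brownian_le_pos (t : ℝ≥0) {ε : ℝ} (hε : 0 < ε) :
    0 < preWienerMeasure {ω | ∀ s : ℝ≥0, s ≤ t → |brownian s ω| ≤ ε} := by
  -- the number of blocks `n` and the block length `τ = t/n ≤ ε²/16`
  obtain ⟨n, hn0, hnτ⟩ : ∃ n : ℕ, 0 < n ∧ ((t / n : ℝ≥0) : ℝ) ≤ ε ^ 2 / 16 := by
    refine ⟨⌈(t : ℝ) * 16 / ε ^ 2⌉₊ + 1, Nat.succ_pos _, ?_⟩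
    have hε2 : 0 < ε ^ 2 / 16 := by positivity
    have hceil : (t : ℝ) * 16 / ε ^ 2 ≤ (⌈(t : ℝ) * 16 / ε ^ 2⌉₊ : ℝ) := Nat.le_ceil _
    have hnpos : (0 : ℝ) < ((⌈(t : ℝ) * 16 / ε ^ 2⌉₊ + 1 : ℕ) : ℝ) := by positivity
    rw [NNReal.coe_div, NNReal.coe_natCast, div_le_iff₀ hnpos]
    have key : (t : ℝ) * 16 / ε ^ 2 ≤ (⌈(t : ℝ) * 16 / ε ^ 2⌉₊ : ℝ) + 1 :=
      hceil.trans (le_add_of_nonneg_right zero_le_one)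
    calc (t : ℝ) = ((t : ℝ) * 16 / ε ^ 2) * (ε ^ 2 / 16) := by field_simp
      _ ≤ ((⌈(t : ℝ) * 16 / ε ^ 2⌉₊ : ℝ) + 1) * (ε ^ 2 / 16) := by gcongr
      _ = ε ^ 2 / 16 * (((⌈(t : ℝ) * 16 / ε ^ 2⌉₊ + 1 : ℕ) : ℝ)) := by push_cast; ring
  set τ : ℝ≥0 := t / n with hτ
  have hnt : (n : ℝ≥0) * τ = t := by
    rw [hτ, mul_div_cancel₀ _ (by exact_mod_cast hn0.ne')]
  -- the block events
  set E : Bool → Set (ℝ≥0 → ℝ) := fun b => {w : ℝ≥0 → ℝ | (∀ n m : ℕ, ((m : ℝ≥0) / 2 ^ n ≤ τ) →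
      |w ((m : ℝ≥0) / 2 ^ n)| ≤ ε / 2) ∧ (if b then w τ ∈ Icc (-(ε / 2)) 0 else w τ ∈ Icc 0 (ε / 2))}
    with hEdef
  have hE : ∀ b, E b = {w : ℝ≥0 → ℝ | (∀ n m : ℕ, ((m : ℝ≥0) / 2 ^ n ≤ τ) →
      |w ((m : ℝ≥0) / 2 ^ n)| ≤ ε / 2) ∧ (if b then w τ ∈ Icc (-(ε / 2)) 0 else w τ ∈ Icc 0 (ε / 2))} :=
    fun b => rfl
  set B : ℕ → Set (ℝ≥0 → ℝ) := fun k => {ω | (fun u => brownian ((k : ℝ≥0) * τ + u) ω -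
      brownian ((k : ℝ≥0) * τ) ω) ∈ E (decide (0 ≤ brownian ((k : ℝ≥0) * τ) ω))} with hBdef
  have hB : ∀ k : ℕ, B k = {ω | (fun u => brownian ((k : ℝ≥0) * τ + u) ω -
      brownian ((k : ℝ≥0) * τ) ω) ∈ E (decide (0 ≤ brownian ((k : ℝ≥0) * τ) ω))} := fun k => rfl
  -- `{first n blocks good} ⊆ {∀ s ≤ t, |B_s| ≤ ε}`
  have hsub : {ω | ∀ j < n, ω ∈ B j} ⊆ {ω | ∀ s : ℝ≥0, s ≤ t → |brownian s ω| ≤ ε} := by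
    intro ω hω s hs
    have h := (abs_brownian_le_of_mem_goodUpTo hE hB hε.le hω).2 s
    rw [hnt] at h
    exact h hs
  refine lt_of_lt_of_le ?_ (measure_mono hsub)
  refine lt_of_lt_of_le ?_ (pow_le_measure_goodUpTo hE hB n)
  refine ENNReal.pow_pos (lt_min ?_ ?_) n
  · rw [hE]; exact blockProb_pos hε hnτ true
  · rw [hE]; exact blockProb_pos hε hnτ false

/-- **Small balls for the pair of independent Brownian motions**: for every `t ≥ 0` and `ε > 0`,
`P(∀ s ≤ t, |B¹_s| ≤ ε ∧ |B²_s| ≤ ε) > 0` under `wienerPair` (product of the two one-dimensional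
small-ball probabilities). [folklore] -/
theorem wienerPair_forall_abs_brownian_le_pos (t : ℝ≥0) {ε : ℝ} (hε : 0 < ε) :
    0 < wienerPair {ω : WienerPair | ∀ s : ℝ≥0, s ≤ t →
      |brownian s ω.1| ≤ ε ∧ |brownian s ω.2| ≤ ε} := by
  haveI := RandomPlanarGeometry.isProbabilityMeasure_preWienerMeasure'
  set A : Set (ℝ≥0 → ℝ) := {ω | ∀ s : ℝ≥0, s ≤ t → |brownian s ω| ≤ ε} with hA
  have hprod : {ω : WienerPair | ∀ s : ℝ≥0, s ≤ t → |brownian s ω.1| ≤ ε ∧ |brownian s ω.2| ≤ ε} =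
      A ×ˢ A := by
    ext ω
    simp only [mem_setOf_eq, mem_prod, hA]
    constructor
    · intro h
      exact ⟨fun s hs => (h s hs).1, fun s hs => (h s hs).2⟩
    · rintro ⟨h1, h2⟩ s hs
      exact ⟨h1 s hs, h2 s hs⟩
  rw [hprod, wienerPair, Measure.prod_prod]
  exact ENNReal.mul_pos (measure_forall_abs_brownian_le_pos t hε).ne'
    (measure_forall_abs_brownian_le_pos t hε).ne'

end Literature.Probability.Process
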